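import Summits.ValiantsHypothesis.ValiantsHypothesis.Theorems.LacunarySymmetroidMatrixDescartesCensusReflectGauss
import Summits.ValiantsHypothesis.ValiantsHypothesis.Theorems.LacunarySymmetroidMatrixDescartesChainBlocks

/-!
# `MatrixDescartes` census — reflective certificates, Part 3: BLOCKS (a kernel row as a chain-calculus block)

HONEST FRAMING.  Verification infrastructure for the finite census of real symmetric lacunary pencils (cells `pub-symmetroid`,
`val-V1-extremal`; seat val-v1x-eng-8).  LOWER bounds only; nothing here bears on the asymptotic crux
`Theses.LacunarySymmetroid.MatrixDescartes` (stmt-ValiantsHypothesis-18050) nor on `VP ≠ VNP`.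

WHY.  The tree's junction calculus (`…ChainJunction`, `…ChainInertia`, `…ChainBlocks`: «`ζ_sym(m, K₁+K₂−1) ≥ ζ₁ + ζ₂` for matching
junction inertia») consumes BLOCKS — an alternation certificate on a strictly increasing support packaged with the SYLVESTER FORMS of its
bottom and top letters — and so far blocks were packed only from the typer's closed-form rows (`m ≤ 3`).  This file packs ANY reflectively
certified row (`certCheckG … = true`, Gaussian kit Part 1G) as a block, so that every junction of kernel rows becomes the one-liner
`Chain.chain_append` instead of an explicit chained pencil with thousands of digits:
* `sylCheck m J P s` — an IN-KERNEL Sylvester check of an integer symmetric letter `J`: the kernel itself computes a rational frame `F`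
  (`ldlFrame`, plain `LDLᵀ` of `PᵀJP` for a small integer pre-congruence `P`, usually `1`) and VERIFIES that `F` is unit upper triangular
  and that `Fᵀ(PᵀJP)F` is diagonal with diagonal signs `s`; the frame (whose entries would run to tens of thousands of digits) is never
  printed.  Soundness `exists_congr_of_sylCheck`: `∃ C` real invertible with `Cᵀ J C = diagonal s` — it rests only on the verified
  identities, not on the elimination routine;
* `block_of_certCheckG` — certificate + `sylCheck` of both end letters ⇒ a `Chain` block (shape of `Chain.block_of_certificate`);
* `block_reverse` (`x ↦ 1/x`: the forms swap), `not_posRootLawAt_of_certificateT_add` (a chain followed by `j` grafted letters).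
[folklore] Elementary (Sylvester forms by `LDLᵀ`; the chain calculus' own soundness theorems); proof by reflection.
-/

-- `Summit.ValiantsHypothesis.ValiantsHypothesis.…` repeats a component by the D-0017 layout
-- (single-conjunct summit), which the `dupNamespace` linter flags; the name is mandated.
set_option linter.dupNamespace false

namespace Summit.ValiantsHypothesis.ValiantsHypothesis.Theorems.LacunarySymmetroidMatrixDescartes.Census.Reflect

open Summit.ValiantsHypothesis.ValiantsHypothesis.Theorems.MatrixDescartes.Negative (PosRootLawAt)
open Summit.ValiantsHypothesis.ValiantsHypothesis.Theorems.LacunarySymmetroidMatrixDescartes.Census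
open scoped BigOperators Matrix

/-! ### Kernel-reducible rational primitives -/

/-- Structural sum over `Fin K` in `ℚ`. [folklore] -/
def finSumQ : (K : ℕ) → (Fin K → ℚ) → ℚ
  | 0, _ => 0
  | K + 1, f => f 0 + finSumQ K (fun l => f l.succ)

/-- `finSumQ` is the `Finset` sum. [folklore] -/
theorem finSumQ_eq (K : ℕ) (f : Fin K → ℚ) : finSumQ K f = ∑ l, f l := by
  induction K with
  | zero => simp [finSumQ]
  | succ K ih => rw [finSumQ, ih, Fin.sum_univ_succ]

/-- Product of two `m × m` rational arrays. [folklore] -/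
def mulQ (m : ℕ) (A B : Fin m → Fin m → ℚ) : Fin m → Fin m → ℚ :=
  fun i j => finSumQ m (fun k => A i k * B k j)

/-- `mulQ` is the matrix product. [folklore] -/
theorem of_mulQ (m : ℕ) (A B : Fin m → Fin m → ℚ) : Matrix.of (mulQ m A B) = Matrix.of A * Matrix.of B := by
  ext i j
  simp [mulQ, finSumQ_eq, Matrix.mul_apply]

/-- The integer array `Pᵀ J P`. [folklore] -/
def conjP (m : ℕ) (J P : Fin m → Fin m → ℤ) : Fin m → Fin m → ℤ :=
  fun i j => finSum m (fun l => finSum m (fun k => P k i * J k l) * P l j)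

/-- `conjP` is `Pᵀ J P`. [folklore] -/
theorem of_conjP (m : ℕ) (J P : Fin m → Fin m → ℤ) :
    Matrix.of (conjP m J P) = (Matrix.of P)ᵀ * Matrix.of J * Matrix.of P := by
  ext i j
  simp [conjP, finSum_eq, Matrix.mul_apply, Matrix.transpose_apply]

/-- UNVERIFIED helper (its output is re-verified by `sylCheck`): the plain `LDLᵀ` frame of a symmetric rational array — a unit upper
triangular `F` with `Fᵀ A F` diagonal whenever all leading principal minors of `A` are nonzero (first pivot `A 0 0`, Schur complement,
recursion on the size). [folklore] -/
def ldlFrame : (n : ℕ) → (Fin n → Fin n → ℚ) → Fin n → Fin n → ℚ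
  | 0, _ => fun _ _ => 0
  | n + 1, A =>
    let u : Fin n → ℚ := fun j => A 0 j.succ / A 0 0
    let S : Fin n → Fin n → ℚ := fun i j => A i.succ j.succ - u i * A 0 j.succ
    let F' : Fin n → Fin n → ℚ := ldlFrame n S
    fun i j => match i, j with
      | ⟨0, _⟩, ⟨0, _⟩ => 1
      | ⟨0, _⟩, ⟨j' + 1, hj⟩ => -finSumQ n (fun k => u k * F' k ⟨j', Nat.lt_of_succ_lt_succ hj⟩)
      | ⟨_ + 1, _⟩, ⟨0, _⟩ => 0
      | ⟨i' + 1, hi⟩, ⟨j' + 1, hj⟩ => F' ⟨i', Nat.lt_of_succ_lt_succ hi⟩ ⟨j', Nat.lt_of_succ_lt_succ hj⟩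

/-- **In-kernel Sylvester check** of an integer symmetric letter `J` against a sign vector `s` (entries `±1`), through a small integer
pre-congruence `P` (usually the identity): `det P ≠ 0`; the computed frame `F = ldlFrame (PᵀJP)` is unit upper triangular;
`Fᵀ (PᵀJP) F` is diagonal and its `i`-th diagonal entry has the sign of `s i`. [folklore] -/
def sylCheck (m : ℕ) (J P : Fin m → Fin m → ℤ) (s : Fin m → ℤ) : Bool :=
  let A : Fin m → Fin m → ℚ := fun i j => (conjP m J P i j : ℚ)
  let F : Fin m → Fin m → ℚ := ldlFrame m A
  let M : Fin m → Fin m → ℚ := mulQ m (mulQ m (fun i j => F j i) A) F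
  !(idet m P == 0)
  && finAll m (fun i => finAll m (fun j =>
        if (j : ℕ) < i then F i j == 0 else if (j : ℕ) = i then F i j == 1 else true))
  && finAll m (fun i => finAll m (fun j => ((i : ℕ) == j) || (M i j == 0)))
  && finAll m (fun i => decide (0 < M i i * (s i : ℚ)))

/-- The real letter of an integer array. [folklore] -/
theorem realLetter_eq_map (m : ℕ) (J : Fin m → Fin m → ℤ) :
    (Matrix.of fun i j => (J i j : ℝ)) = (Matrix.of fun i j => (J i j : ℚ)).map (Rat.castHom ℝ) := by
  ext i j; simp

/-- **Soundness of the Sylvester check**: `sylCheck m J P s = true` gives a real invertible `C` with `Cᵀ J C = diagonal s`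
(`C = P · F · diag √(s i / pivot i)`). [folklore] -/
theorem exists_congr_of_sylCheck {m : ℕ} {J P : Fin m → Fin m → ℤ} {s : Fin m → ℤ} (h : sylCheck m J P s = true) :
    ∃ C : Matrix (Fin m) (Fin m) ℝ, C.det ≠ 0 ∧
      Cᵀ * (Matrix.of fun i j => (J i j : ℝ)) * C = Matrix.diagonal (fun i => (s i : ℝ)) := by
  simp only [sylCheck, Bool.and_eq_true, Bool.not_eq_true', beq_eq_false_iff_ne, ne_eq] at h
  obtain ⟨⟨⟨hP, hF⟩, hM⟩, hs⟩ := h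
  -- names for the computed arrays
  set A : Fin m → Fin m → ℚ := fun i j => (conjP m J P i j : ℚ) with hA
  set F : Fin m → Fin m → ℚ := ldlFrame m A with hFdef
  set M : Fin m → Fin m → ℚ := mulQ m (mulQ m (fun i j => F j i) A) F with hMdef
  -- rational matrices
  set Pq : Matrix (Fin m) (Fin m) ℚ := Matrix.of fun i j => (P i j : ℚ) with hPq
  set Jq : Matrix (Fin m) (Fin m) ℚ := Matrix.of fun i j => (J i j : ℚ) with hJq
  set Fq : Matrix (Fin m) (Fin m) ℚ := Matrix.of F with hFq
  have hAq : Matrix.of A = Pqᵀ * Jq * Pq := by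
    have h1 : Matrix.of A = (Matrix.of (conjP m J P)).map (Int.castRingHom ℚ) := by
      ext i j; simp [hA]
    rw [h1, of_conjP, Matrix.map_mul, Matrix.map_mul, Matrix.transpose_map]
    rfl
  have hMq : Matrix.of M = Fqᵀ * (Pqᵀ * Jq * Pq) * Fq := by
    rw [hMdef, of_mulQ, of_mulQ, hAq]
    rfl
  -- `M` is diagonal
  have hdiag : Matrix.of M = Matrix.diagonal (fun i => M i i) := by
    ext i j
    by_cases hij : i = j
    · subst hij; simp
    · have hz := of_finAll (of_finAll hM i) j
      simp only [Bool.or_eq_true, beq_iff_eq, Fin.val_eq_val, hij, false_or] at hz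
      rw [Matrix.of_apply, Matrix.diagonal_apply_ne _ hij, hz]
  -- `F` is unit upper triangular, hence `det F = 1`
  have hFtri : ∀ i j : Fin m, (j : ℕ) < i → F i j = 0 := fun i j hlt => by
    have hz := of_finAll (of_finAll hF i) j
    simp only [hlt, if_true, beq_iff_eq] at hz
    exact hz
  have hFone : ∀ i : Fin m, F i i = 1 := fun i => by
    have hz := of_finAll (of_finAll hF i) i
    simp only [lt_irrefl, if_false, if_true, beq_iff_eq] at hz
    exact hz
  have hFdet : Fq.det = 1 := by
    have htri : Fq.BlockTriangular id := fun i j hlt => by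
      simpa [hFq] using hFtri i j (by simpa using hlt)
    rw [Matrix.det_of_upperTriangular htri]
    simp [hFq, hFone]
  -- `det P ≠ 0`
  have hPdet : Pq.det ≠ 0 := by
    have h1 : Pq = (Matrix.of P).map (Int.castRingHom ℚ) := by ext i j; simp [hPq]
    rw [h1, ← RingHom.mapMatrix_apply, ← RingHom.map_det, ← idet_eq]
    intro h0
    exact hP (by exact_mod_cast (show ((idet m P : ℤ) : ℚ) = 0 from h0))
  -- the rational frame
  set Cq : Matrix (Fin m) (Fin m) ℚ := Pq * Fq with hCq
  have hCqe : Cqᵀ * Jq * Cq = Matrix.diagonal (fun i => M i i) := by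
    rw [← hdiag, hMq, hCq, Matrix.transpose_mul]
    simp only [Matrix.mul_assoc]
  have hCqdet : Cq.det ≠ 0 := by
    rw [hCq, Matrix.det_mul, hFdet, mul_one]; exact hPdet
  -- to the reals, then normalise the diagonal to the signs `s`
  set φ : ℚ →+* ℝ := Rat.castHom ℝ with hφ
  refine Chain.exists_congr_diagonal_signs (p := fun i => (M i i : ℝ)) ⟨Cq.map φ, ?_, ?_⟩ (fun i => (s i : ℝ)) ?_
  · rw [← RingHom.mapMatrix_apply, ← RingHom.map_det]
    exact (map_ne_zero φ).mpr hCqdet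
  · rw [realLetter_eq_map, ← hJq, ← hφ, ← Matrix.transpose_map, ← Matrix.map_mul, ← Matrix.map_mul, hCqe,
      Matrix.diagonal_map (map_zero φ)]
    rfl
  · intro i
    have hz := of_finAll hs i
    simp only [decide_eq_true_eq] at hz
    exact_mod_cast hz

/-! ### Reflective certificates as chain-calculus blocks -/

/-- The alternating configuration of a Gaussian reflective certificate, with the letters EXPLICIT (the real casts of `S`). [folklore] -/
theorem alternatingR_of_certCheckG {m K N : ℕ} {d : Fin K → ℕ} {S : Fin K → Fin m → Fin m → ℤ}
    {a b : Fin (N + 1) → ℕ} (h : certCheckG m K N d S a b = true) (hN : 1 ≤ N) :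
    ∃ τ : Fin (N + 1) → ℝ,
      (∀ l, (Matrix.of fun i j => (S l i j : ℝ)).IsSymm) ∧ StrictMono τ ∧ (∀ j, 0 < τ j) ∧
      (∀ j, (∑ l, τ j ^ d l • (Matrix.of fun i j => (S l i j : ℝ))).det ≠ 0) ∧
      ∀ i : Fin N, (∑ l, τ i.castSucc ^ d l • (Matrix.of fun i j => (S l i j : ℝ))).det *
        (∑ l, τ i.succ ^ d l • (Matrix.of fun i j => (S l i j : ℝ))).det < 0 := by
  rw [certCheckG_eq] at h
  simp only [certCheck, Bool.and_eq_true] at h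
  obtain ⟨hsymm, hpos, hmono, hsign⟩ := h
  have hS : ∀ l i j, S l i j = S l j i := fun l i j => by
    simpa using of_finAll (of_finAll (of_finAll hsymm l) i) j
  have ha : ∀ j, 0 < a j := fun j => by
    have := of_finAll hpos j; simp only [Bool.and_eq_true, decide_eq_true_eq] at this; exact this.1
  have hb : ∀ j, 0 < b j := fun j => by
    have := of_finAll hpos j; simp only [Bool.and_eq_true, decide_eq_true_eq] at this; exact this.2
  have hlt : ∀ i : Fin N, a i.castSucc * b i.succ < a i.succ * b i.castSucc := fun i => by
    simpa using of_finAll hmono i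
  have hsg : ∀ i : Fin N, signAt m K (finMax K d) d S (a i.castSucc) (b i.castSucc)
      * signAt m K (finMax K d) d S (a i.succ) (b i.succ) = -1 := fun i => by
    simpa using of_finAll hsign i
  set SR : Fin K → Matrix (Fin m) (Fin m) ℝ := fun l => Matrix.of fun i j => (S l i j : ℝ) with hSR
  let τ : Fin (N + 1) → ℝ := fun j => (a j : ℝ) / (b j : ℝ)
  have hbR : ∀ j, (0 : ℝ) < b j := fun j => by exact_mod_cast hb j
  have hτpos : ∀ j, 0 < τ j := fun j => div_pos (by exact_mod_cast ha j) (hbR j)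
  have hτ : StrictMono τ := by
    refine Fin.strictMono_iff_lt_succ.mpr (fun i => ?_)
    show (a i.castSucc : ℝ) / b i.castSucc < (a i.succ : ℝ) / b i.succ
    rw [div_lt_div_iff₀ (hbR _) (hbR _)]
    exact_mod_cast hlt i
  have hD : ∀ l, d l ≤ finMax K d := le_finMax d
  have key : ∀ j : Fin (N + 1),
      ((b j : ℝ) ^ finMax K d) ^ m * (∑ l, τ j ^ d l • SR l).det
        = (idet m (evalAt m K (finMax K d) d S (a j) (b j)) : ℝ) := fun j =>
    det_evalAt d hD S (a j) (b j) (ne_of_gt (hbR j))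
  have hc : ∀ j : Fin (N + 1), (0 : ℝ) < ((b j : ℝ) ^ finMax K d) ^ m := fun j =>
    pow_pos (pow_pos (hbR j) _) _
  have halt : ∀ i : Fin N,
      (∑ l, τ i.castSucc ^ d l • SR l).det * (∑ l, τ i.succ ^ d l • SR l).det < 0 := by
    intro i
    have hneg := mul_neg_of_sign (hsg i)
    rw [← key, ← key] at hneg
    have hcc : (0 : ℝ) < ((b i.castSucc : ℝ) ^ finMax K d) ^ m * ((b i.succ : ℝ) ^ finMax K d) ^ m :=
      mul_pos (hc _) (hc _)
    have hprod : ((b i.castSucc : ℝ) ^ finMax K d) ^ m * ((b i.succ : ℝ) ^ finMax K d) ^ m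
        * ((∑ l, τ i.castSucc ^ d l • SR l).det * (∑ l, τ i.succ ^ d l • SR l).det) < 0 := by
      calc ((b i.castSucc : ℝ) ^ finMax K d) ^ m * ((b i.succ : ℝ) ^ finMax K d) ^ m
            * ((∑ l, τ i.castSucc ^ d l • SR l).det * (∑ l, τ i.succ ^ d l • SR l).det)
          = (((b i.castSucc : ℝ) ^ finMax K d) ^ m * (∑ l, τ i.castSucc ^ d l • SR l).det)
            * ((((b i.succ : ℝ) ^ finMax K d) ^ m) * (∑ l, τ i.succ ^ d l • SR l).det) := by ring
        _ < 0 := hneg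
    exact lt_of_not_ge (fun hge => absurd hprod (not_lt.mpr (mul_nonneg hcc.le hge)))
  exact ⟨τ, fun l => realLetters_isSymm hS l, hτ, hτpos,
    Graft.ne_zero_of_alternating hN (fun j => (∑ l, τ j ^ d l • SR l).det) halt, halt⟩

/-- Strict monotonicity of a support from the Boolean successor test. [folklore] -/
theorem strictMono_of_finAll {K : ℕ} {d : Fin (K + 1) → ℕ}
    (hd : finAll K (fun i => decide (d i.castSucc < d i.succ)) = true) : StrictMono d :=
  Fin.strictMono_iff_lt_succ.mpr fun i => by simpa using of_finAll hd i

/-- **Reflective block packer.**  A Gaussian reflective certificate (`K+1` letters, `N ≥ 1` alternations) on a strictly increasing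
support, together with in-kernel Sylvester checks of its bottom letter (signs `sb`) and top letter (signs `st`), is a BLOCK of the chain
calculus (`…ChainBlocks`) with bottom form `diagonal sb` and top form `diagonal st`. [folklore] -/
theorem block_of_certCheckG {m K N : ℕ} {d : Fin (K + 1) → ℕ} {S : Fin (K + 1) → Fin m → Fin m → ℤ}
    {a b : Fin (N + 1) → ℕ} (h : certCheckG m (K + 1) N d S a b = true) (hN : 1 ≤ N)
    (hd : finAll K (fun i => decide (d i.castSucc < d i.succ)) = true)
    {Pb : Fin m → Fin m → ℤ} {sb : Fin m → ℤ} (hb : sylCheck m (S 0) Pb sb = true)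
    {Pt : Fin m → Fin m → ℤ} {st : Fin m → ℤ} (ht : sylCheck m (S (Fin.last K)) Pt st = true) :
    ∃ (e : Fin (K + 1) → ℕ) (T : Fin (K + 1) → Matrix (Fin m) (Fin m) ℝ) (σ : Fin (N + 1) → ℝ),
      StrictMono e ∧
      (∀ h1 : 0 < K + 1, ∃ C : Matrix (Fin m) (Fin m) ℝ, C.det ≠ 0 ∧
        Cᵀ * T ⟨0, h1⟩ * C = Matrix.diagonal (fun i => (sb i : ℝ))) ∧
      (∀ h1 : 0 < K + 1, ∃ C : Matrix (Fin m) (Fin m) ℝ, C.det ≠ 0 ∧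
        Cᵀ * T ⟨K + 1 - 1, Nat.sub_lt h1 one_pos⟩ * C = Matrix.diagonal (fun i => (st i : ℝ))) ∧
      (∀ l, (T l).IsSymm) ∧ StrictMono σ ∧ (∀ j, 0 < σ j) ∧ (∀ j, (∑ l, σ j ^ e l • T l).det ≠ 0) ∧
      ∀ j : Fin N, (∑ l, σ j.castSucc ^ e l • T l).det * (∑ l, σ j.succ ^ e l • T l).det < 0 := by
  obtain ⟨τ, hS, hτ, hpos, hne, halt⟩ := alternatingR_of_certCheckG h hN
  refine ⟨d, fun l => Matrix.of fun i j => (S l i j : ℝ), τ, strictMono_of_finAll hd, fun h1 => ?_, fun h1 => ?_,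
    hS, hτ, hpos, hne, halt⟩
  · exact exists_congr_of_sylCheck hb
  · have hidx : (⟨K + 1 - 1, Nat.sub_lt h1 one_pos⟩ : Fin (K + 1)) = Fin.last K := Fin.ext rfl
    rw [hidx]
    exact exists_congr_of_sylCheck ht

/-- **Reversal of a block** (`x ↦ 1/x`): same number of letters and alternations, bottom and top forms swapped. [folklore] -/
theorem block_reverse {m K N : ℕ} {q r : Fin m → ℝ}
    (h : ∃ (e : Fin (K + 1) → ℕ) (T : Fin (K + 1) → Matrix (Fin m) (Fin m) ℝ) (σ : Fin (N + 1) → ℝ),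
      StrictMono e ∧
      (∀ h1 : 0 < K + 1, ∃ C : Matrix (Fin m) (Fin m) ℝ, C.det ≠ 0 ∧ Cᵀ * T ⟨0, h1⟩ * C = Matrix.diagonal q) ∧
      (∀ h1 : 0 < K + 1, ∃ C : Matrix (Fin m) (Fin m) ℝ, C.det ≠ 0 ∧
        Cᵀ * T ⟨K + 1 - 1, Nat.sub_lt h1 one_pos⟩ * C = Matrix.diagonal r) ∧
      (∀ l, (T l).IsSymm) ∧ StrictMono σ ∧ (∀ j, 0 < σ j) ∧ (∀ j, (∑ l, σ j ^ e l • T l).det ≠ 0) ∧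
      ∀ j : Fin N, (∑ l, σ j.castSucc ^ e l • T l).det * (∑ l, σ j.succ ^ e l • T l).det < 0) :
    ∃ (e : Fin (K + 1) → ℕ) (T : Fin (K + 1) → Matrix (Fin m) (Fin m) ℝ) (σ : Fin (N + 1) → ℝ),
      StrictMono e ∧
      (∀ h1 : 0 < K + 1, ∃ C : Matrix (Fin m) (Fin m) ℝ, C.det ≠ 0 ∧ Cᵀ * T ⟨0, h1⟩ * C = Matrix.diagonal r) ∧
      (∀ h1 : 0 < K + 1, ∃ C : Matrix (Fin m) (Fin m) ℝ, C.det ≠ 0 ∧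
        Cᵀ * T ⟨K + 1 - 1, Nat.sub_lt h1 one_pos⟩ * C = Matrix.diagonal q) ∧
      (∀ l, (T l).IsSymm) ∧ StrictMono σ ∧ (∀ j, 0 < σ j) ∧ (∀ j, (∑ l, σ j ^ e l • T l).det ≠ 0) ∧
      ∀ j : Fin N, (∑ l, σ j.castSucc ^ e l • T l).det * (∑ l, σ j.succ ^ e l • T l).det < 0 := by
  obtain ⟨e, T, σ, he, hb, ht, hT, hσ, hpos, hne, halt⟩ := h
  obtain ⟨e', T', σ', -, hT'e, -, he', hT', hσ', hpos', hne', halt'⟩ :=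
    Chain.exists_alternating_reverse e T he hT σ hσ hpos hne halt
  have h0 : (⟨0, Nat.succ_pos K⟩ : Fin (K + 1)) = 0 := rfl
  have hl : (⟨K + 1 - 1, Nat.sub_lt (Nat.succ_pos K) one_pos⟩ : Fin (K + 1)) = Fin.last K := Fin.ext rfl
  refine ⟨e', T', σ', he', fun h1 => ?_, fun h1 => ?_, hT', hσ', hpos', hne', halt'⟩
  · have h2 := ht h1
    rw [hl] at h2
    rw [h0, hT'e, Fin.rev_zero]
    exact h2
  · have h2 := hb h1
    rw [h0] at h2
    rw [hl, hT'e, Fin.rev_last]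
    exact h2

/-- **A chain followed by `j` grafted letters**: a packaged certificate with `K` letters and `N ≥ 1` alternations refutes
`PosRootLawAt m (K + j) (N + j·m − 1)` (`+m` alternations per added letter, `Graft.exists_alternating_add`). [folklore] -/
theorem not_posRootLawAt_of_certificateT_add {m K N : ℕ} {r : Fin m → ℝ} (hN : 1 ≤ N)
    (h : ∃ (d : Fin K → ℕ) (S : Fin K → Matrix (Fin m) (Fin m) ℝ) (τ : Fin (N + 1) → ℝ),
      StrictMono d ∧ (∀ h1 : 0 < K, ∃ C : Matrix (Fin m) (Fin m) ℝ, C.det ≠ 0 ∧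
        Cᵀ * S ⟨K - 1, Nat.sub_lt h1 one_pos⟩ * C = Matrix.diagonal r) ∧
      (∀ l, (S l).IsSymm) ∧ StrictMono τ ∧ (∀ j, 0 < τ j) ∧ (∀ j, (∑ l, τ j ^ d l • S l).det ≠ 0) ∧
      ∀ j : Fin N, (∑ l, τ j.castSucc ^ d l • S l).det * (∑ l, τ j.succ ^ d l • S l).det < 0) (j : ℕ) :
    ¬ PosRootLawAt m (K + j) (N + j * m - 1) := by
  obtain ⟨d, S, τ, -, -, hS, hτ, hpos, hne, halt⟩ := h
  obtain ⟨d', S', τ', hS', hτ', hpos', -, halt'⟩ := Graft.exists_alternating_add ⟨d, S, τ, hS, hτ, hpos, hne, halt⟩ j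
  exact Graft.not_posRootLawAt_of_alternating (by omega) d' S' hS' τ' hτ' hpos' halt'

/-! ### Smoke test on the kit's toy row `diag(−1,−2) + t·1` (`(2,2)`, 2 alternations, bottom form `(−1,−1)`, top form `(1,1)`):
the block, its reversal, and the self-junction ⇒ `ζ(2,3) ≥ 4`. -/

/-- The toy row as a block. [folklore] -/
theorem toy_block : ∃ (e : Fin (1 + 1) → ℕ) (T : Fin (1 + 1) → Matrix (Fin 2) (Fin 2) ℝ) (σ : Fin (2 + 1) → ℝ),
    StrictMono e ∧
    (∀ h1 : 0 < 1 + 1, ∃ C : Matrix (Fin 2) (Fin 2) ℝ, C.det ≠ 0 ∧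
      Cᵀ * T ⟨0, h1⟩ * C = Matrix.diagonal (fun i => ((![-1, -1] : Fin 2 → ℤ) i : ℝ))) ∧
    (∀ h1 : 0 < 1 + 1, ∃ C : Matrix (Fin 2) (Fin 2) ℝ, C.det ≠ 0 ∧
      Cᵀ * T ⟨1 + 1 - 1, Nat.sub_lt h1 one_pos⟩ * C = Matrix.diagonal (fun i => ((![1, 1] : Fin 2 → ℤ) i : ℝ))) ∧
    (∀ l, (T l).IsSymm) ∧ StrictMono σ ∧ (∀ j, 0 < σ j) ∧ (∀ j, (∑ l, σ j ^ e l • T l).det ≠ 0) ∧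
    ∀ j : Fin 2, (∑ l, σ j.castSucc ^ e l • T l).det * (∑ l, σ j.succ ^ e l • T l).det < 0 :=
  block_of_certCheckG (m := 2) (K := 1) (N := 2) (d := ![0, 1])
    (S := ![![![-1, 0], ![0, -2]], ![![1, 0], ![0, 1]]]) (a := ![1, 3, 4]) (b := ![2, 2, 1])
    (by decide +kernel) (by norm_num) (by decide +kernel)
    (Pb := ![![1, 0], ![0, 1]]) (sb := ![-1, -1]) (by decide +kernel)
    (Pt := ![![1, 0], ![0, 1]]) (st := ![1, 1]) (by decide +kernel)

/-- `ζ(2,3) ≥ 4` by the self-junction `toy ▹ toyʳ` (junction inertia `(1,1)` on both sides). [folklore] -/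
example : ¬ PosRootLawAt 2 3 3 := by
  have h := Chain.not_posRootLawAt_of_certificateT (by norm_num)
    (Chain.chain_append (by norm_num) (Chain.chain_of_block toy_block) (block_reverse toy_block)
      (Equiv.refl (Fin 2)) (by intro i; fin_cases i <;> simp))
  norm_num at h
  exact h

end Summit.ValiantsHypothesis.ValiantsHypothesis.Theorems.LacunarySymmetroidMatrixDescartes.Census.Reflect
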